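import Literature.Probability.RandomPlanarGeometry.ParaObservableFarField
import Mathlib.Analysis.SpecialFunctions.Complex.LogBounds
import HarnessLib

/-!
# The spin-5/8 (self-avoiding walk) half-plane observable: far-field expansion

Topic `Literature/Probability/RandomPlanarGeometry` (deterministic chordal Loewner calculus;
theorems only, no definition, no named fact). Self-avoiding-walk (`κ = 8/3`) companion of
`LoewnerFarField.lean` (FK-Ising observable, exponent `1/2`, `κ = 16/3`), of its spin-Ising
appendix (`κ = 3`) and of `ParaObservableFarField.lean` (percolation, exponent `1/3`, `κ = 6`);
the short-time continuity of the same observable is the sibling file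
`SAWParaObservableShortTime.lean`.

The conjectural half-plane martingale observable of the scaling limit of the critical
self-avoiding walk is the spin-`5/8` parafermion (Duminil-Copin–Smirnov, Ann. of Math. 175
(2012), §4, Conjecture 2 and the discussion following it: the parafermionic observable of spin
`σ = 5/8` and its conjectured limit `(φ'(z)/φ'(b))^{5/8}`; Lawler–Schramm–Werner, Proc. Sympos.
Pure Math. 72 (2004), §4.1; Chelkak–Duminil-Copin–Hongler–Kemppainen–Smirnov, C. R. Math. 352
(2014), §3 for the martingale-observable method). In the slit half-plane uniformized by `g_t`,
driving value `W_t`, it is (up to a `t`-independent factor) `(w² g_t'(w)/(g_t(w) - W_t)²)^{5/8}`,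
which we write with PRINCIPAL logarithms,

  `N_t(w) = exp ((5/8) (2 Log w + Log g_t'(w) - 2 Log (g_t(w) - W_t)))`.

There is deliberately NO new definition here: every statement is written with this explicit
expression, so that it applies by `rfl` to any definition with this body (e.g. the SAW route's
`paraObs` / `paraObsCap` of the summit `CriticalPhenomena`). Results, all PROVED:

* `FarRegime.norm_sawParaObservable_sub_le` — **the far-field expansion** at `w = iy` in the
  tree's far-field regime `Loewner.FarRegime W (iy) t K` (`64 (K + √t) ≤ y`, `|W| ≤ K` on
  `[0, t]`), `α = (K + √t)/y ≤ 1/64`: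
  `‖N_t(iy) - (1 + (5/4) W_t/(iy) + (45/32)(W_t² - (8/3) t)/(iy)²)‖ ≤ 100 α³`.
  Inputs (all from `LoewnerFarField.lean`): `g_t - W_t = iy (1 + v)` with
  `v = -W_t/(iy) + 2t/(iy)² + O(3α³)` (`FarRegime.norm_v_sub_le`) and `g_t' = exp J`,
  `J = -2t/(iy)² + O(10α³)` (`FarRegime.norm_exponent_sub_le`, `hasDerivAt_map`). The
  branches are pinned by `Log (iy (1+v)) = Log (iy) + Log (1+v)` (`Re (1+v) > 0`,
  `arg (iy) = π/2`) and `Log (exp J) = J` (`|Im J| ≤ 1 < π`), so that the exponent is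
  `E = (5/8)(J - 2 Log (1+v))` — no `Log (iy)` is left — and then
  `Log (1+v) = v - v²/2 + O(v³)`, `exp E = 1 + E + E²/2 + O(E³)`;
* `FarRegime.saw_main_term_eq`, `FarRegime.abs_im_sawParaObservable_add_le`,
  `FarRegime.abs_re_sawParaObservable_sub_le` — on the imaginary axis the two coefficients
  separate: `Im N_t(iy) = -(5/4) W_t/y + O(α³)`, `Re N_t(iy) = 1 - (45/32)(W_t² - (8/3)t)/y² + O(α³)`
  — whence the martingales `W_t` and `W_t² - (8/3) t` of a chain whose observable is a
  martingale, i.e. `κ = 8/3`.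

Elementary inputs proved here: the cubic Taylor bounds `Log (1+v) = v - v²/2 + O(‖v‖³)`
(`‖v‖ ≤ 1/2`) and `exp x = 1 + x + x²/2 + O(‖x‖³)` (`‖x‖ ≤ 1`), `Re (1+v) > 0` for
`‖v‖ ≤ 1/2`, the branch identity `Log (iy · u) = Log (iy) + Log u` for `y > 0`, `Re u > 0`,
and `Log (exp J) = J` for `‖J‖ ≤ 1`. The constant `100` is a generous absolute constant (the
proof gives `44`); only its existence matters downstream.

## Mathlib

USED: `Complex.log_mul_eq_add_log_iff`, `Complex.arg_eq_pi_div_two_iff`,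
`Complex.abs_arg_lt_pi_div_two_iff`, `Complex.log_exp`, `Complex.norm_log_sub_logTaylor_le`,
`Complex.exp_bound`. From the tree: `Loewner.FarRegime.*`, `Loewner.hasDerivAt_map`
(`LoewnerFarField.lean`, `LoewnerMapProofs.lean`). Mathlib has no Loewner chains.

## References

* H. Duminil-Copin, S. Smirnov, *The connective constant of the honeycomb lattice equals
  `√(2+√2)`*, Ann. of Math. (2) 175 (2012) 1653–1665, §4 (Conjecture 2 and the parafermionic
  observable of spin `5/8`).
* G. F. Lawler, O. Schramm, W. Werner, *On the scaling limit of planar self-avoiding walk*,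
  Proc. Sympos. Pure Math. 72 (2004) 339–364, §4.1.
* D. Chelkak, H. Duminil-Copin, C. Hongler, A. Kemppainen, S. Smirnov, *Convergence of Ising
  interfaces to Schramm's SLE curves*, C. R. Math. Acad. Sci. Paris 352 (2014) 157–161, §3.
* G. F. Lawler, *Conformally Invariant Processes in the Plane*, AMS (2005), Ch. 4 §4.1.
-/

noncomputable section

open Set Filter Topology Metric MeasureTheory Complex
open scoped NNReal

namespace Literature.Probability.RandomPlanarGeometry

namespace Loewner

/-! ### Elementary expansions and branches of the principal logarithm -/

section Elementary

/-- The cubic Taylor bound of the principal logarithm: `‖Log (1+v) - (v - v²/2)‖ ≤ ‖v‖³` for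
`‖v‖ ≤ 1/2` (Mathlib's `Complex.norm_log_sub_logTaylor_le 2` and `(1 - ‖v‖)⁻¹ ≤ 2`).
[folklore] -/
theorem norm_log_one_add_sub_quadratic_le {v : ℂ} (hv : ‖v‖ ≤ 1 / 2) :
    ‖log (1 + v) - (v - v ^ 2 / 2)‖ ≤ ‖v‖ ^ 3 := by
  have hv1 : ‖v‖ < 1 := by linarith
  have h := norm_log_sub_logTaylor_le 2 hv1
  have ht : logTaylor 3 v = v - v ^ 2 / 2 := by
    simp [logTaylor, Finset.sum_range_succ]
    ring
  rw [ht] at h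
  norm_num at h
  refine h.trans ?_
  have hinv : (1 - ‖v‖)⁻¹ ≤ 2 := by
    rw [inv_le_comm₀ (by linarith) (by norm_num)]; linarith
  have h3 : 0 ≤ ‖v‖ ^ 3 := by positivity
  calc ‖v‖ ^ 3 * (1 - ‖v‖)⁻¹ / 3 ≤ ‖v‖ ^ 3 * 2 / 3 := by gcongr
    _ ≤ ‖v‖ ^ 3 := by linarith

/-- The cubic Taylor bound of the exponential: `‖exp x - (1 + x + x²/2)‖ ≤ ‖x‖³` for `‖x‖ ≤ 1`
(Mathlib's `Complex.exp_bound`). [folklore] -/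
theorem norm_exp_sub_quadratic_le {x : ℂ} (hx : ‖x‖ ≤ 1) :
    ‖cexp x - (1 + x + x ^ 2 / 2)‖ ≤ ‖x‖ ^ 3 := by
  have h := Complex.exp_bound hx (n := 3) (by norm_num)
  have hsum : ∑ m ∈ Finset.range 3, x ^ m / (m.factorial : ℂ) = 1 + x + x ^ 2 / 2 := by
    simp [Finset.sum_range_succ, Nat.factorial]
  rw [hsum] at h
  refine h.trans ?_
  have : ((Nat.succ 3 : ℕ) : ℝ) * ((Nat.factorial 3 : ℕ) * (3 : ℕ) : ℝ)⁻¹ ≤ 1 := by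
    norm_num [Nat.factorial]
  calc ‖x‖ ^ 3 * (((Nat.succ 3 : ℕ) : ℝ) * ((Nat.factorial 3 : ℕ) * (3 : ℕ) : ℝ)⁻¹)
      ≤ ‖x‖ ^ 3 * 1 := by gcongr
    _ = ‖x‖ ^ 3 := mul_one _

/-- For `‖v‖ ≤ 1/2`, `1 + v` has positive real part. [folklore] -/
theorem re_one_add_pos {v : ℂ} (hv : ‖v‖ ≤ 1 / 2) : 0 < (1 + v).re := by
  have h := (abs_le.1 (abs_re_le_norm v)).1
  simp only [add_re, one_re]
  linarith

/-- **Branch of the logarithm of a product on the positive imaginary axis**: for `y > 0` and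
`Re u > 0`, `Log (iy · u) = Log (iy) + Log u` (`arg (iy) = π/2` and `|arg u| < π/2`, so the sum
of the arguments stays in `(-π, π]`). [folklore] -/
theorem log_I_mul_mul_of_re_pos {y : ℝ} (hy : 0 < y) {u : ℂ} (hu : 0 < u.re) :
    log (I * y * u) = log (I * y) + log u := by
  have hz : (I * y : ℂ) ≠ 0 := mul_ne_zero I_ne_zero (ofReal_ne_zero.2 hy.ne')
  have hu0 : u ≠ 0 := fun h0 ↦ by simp [h0] at hu
  have harg : arg (I * y) = Real.pi / 2 :=
    arg_eq_pi_div_two_iff.2 ⟨by simp, by simpa using hy⟩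
  have hau := abs_lt.1 (abs_arg_lt_pi_div_two_iff.2 (Or.inl hu))
  rw [log_mul_eq_add_log_iff hz hu0, harg]
  constructor <;> linarith [Real.pi_pos]

/-- `Log (exp J) = J` when `‖J‖ ≤ 1` (`|Im J| ≤ 1 < π`). [folklore] -/
theorem log_exp_of_norm_le_one {J : ℂ} (hJ : ‖J‖ ≤ 1) : log (cexp J) = J := by
  have h := abs_le.1 ((abs_im_le_norm J).trans hJ)
  exact log_exp (by linarith [Real.two_le_pi]) (by linarith [Real.two_le_pi])

end Elementary

/-! ### Far-field expansion of the spin-5/8 observable on the imaginary axis -/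

namespace FarRegime

variable {W : ℝ≥0 → ℝ} {y : ℝ} {t : ℝ≥0} {K : ℝ}

/-- **Second-order far-field expansion of the spin-5/8 (self-avoiding-walk) observable** at
`w = iy`: for a continuous driving function `W` with `|W_s| ≤ K` on `[0, t]` and
`64 (K + √t) ≤ y`,
`‖exp((5/8)(2 Log(iy) + Log g_t'(iy) - 2 Log(g_t(iy) - W_t))) - (1 + (5/4) W_t/(iy) + (45/32)(W_t² - (8/3)t)/(iy)²)‖ ≤ 100 ((K + √t)/y)³`.
With `g_t - W_t = iy(1+v)`, `g_t' = e^J` the exponent is `(5/8)(J - 2 Log(1+v))` (principal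
branches: `Re(1+v) > 0`, `|Im J| < π`), `= (5/4) W_t/(iy) + (5/8)(W_t² - 6t)/(iy)² + O(α³)`, and
`e^E = 1 + E + E²/2 + O(E³)`; `(5/8)(W² - 6t) + (25/32) W² = (45/32)(W² - (8/3) t)`. The two
coefficients are the martingales `W_t`, `W_t² - (8/3)t` of the driving function of `SLE(8/3)`.
[cite: DuminilCopinSmirnov2012, §4 Conjecture 2] -/
theorem norm_sawParaObservable_sub_le (h : FarRegime W (I * y) t K) (hy : 0 < y) :
    ‖cexp ((5 / 8 : ℂ) * (2 * log (I * y) + log (deriv (map W t) (I * y)) -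
          2 * log (map W t (I * y) - W t))) -
        (1 + (5 / 4 : ℂ) * (W t : ℂ) / (I * y) +
          (45 / 32 : ℂ) * ((W t : ℂ) ^ 2 - (8 / 3 : ℂ) * t) / (I * y) ^ 2)‖ ≤
      100 * ((K + Real.sqrt t) / ‖(I * y : ℂ)‖) ^ 3 := by
  obtain ⟨g, hg⟩ := h.exists_sol
  have hK := h.K_le
  have ht := h.t_le
  have hα := h.alpha_le
  have hα0 := h.alpha_nonneg
  have hv0 := h.norm_u_le hg (s := t) ⟨t.coe_nonneg, le_rfl⟩
  have hv1 := h.norm_v_sub_le hg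
  have hJ := h.norm_exponent_sub_le hg
  have hmap : map W t (I * y) = g t := by
    have := h.map_eq hg (s := t) ⟨t.coe_nonneg, le_rfl⟩
    rwa [Real.toNNReal_coe] at this
  have hder : deriv (map W t) (I * y) =
      cexp (∫ s in (0 : ℝ)..t, (-2 : ℂ) / ((g s - W s.toNNReal) * (g s - W s.toNNReal))) :=
    (hasDerivAt_map h.cont h.flow.1 hg).deriv
  have hWt : ‖(W t : ℂ)‖ ≤ K := by
    rw [norm_real, Real.norm_eq_abs]
    have := h.bound t ⟨t.coe_nonneg, le_rfl⟩
    rwa [Real.toNNReal_coe] at this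
  have hρ := h.pos
  have hz := h.z_ne_zero
  set z : ℂ := I * y with hzdef
  set α := (K + Real.sqrt t) / ‖z‖ with hαdef
  rw [Real.toNNReal_coe] at hv0
  set J := ∫ s in (0 : ℝ)..t, (-2 : ℂ) / ((g s - W s.toNNReal) * (g s - W s.toNNReal)) with hJdef
  set v := (g t - W t - z) / z with hvdef
  set a : ℂ := -(W t : ℂ) / z with hadef
  set b : ℂ := 2 * t / z ^ 2 with hbdef
  have hα2 : α ^ 2 ≤ α / 64 := by
    calc α ^ 2 = α * α := sq α
      _ ≤ α * (1 / 64) := by gcongr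
      _ = α / 64 := by ring
  have hα3 : α ^ 3 ≤ α ^ 2 / 64 := by
    calc α ^ 3 = α ^ 2 * α := by ring
      _ ≤ α ^ 2 * (1 / 64) := by gcongr
      _ = α ^ 2 / 64 := by ring
  -- sizes of the coefficients
  have ha : ‖a‖ ≤ α := by
    rw [hadef, norm_div, norm_neg, div_le_iff₀ hρ]; exact hWt.trans hK
  have hb : ‖b‖ ≤ 2 * α ^ 2 := by
    rw [hbdef, norm_div, norm_mul, norm_pow, Complex.norm_real, Real.norm_eq_abs,
      abs_of_nonneg t.coe_nonneg]
    simp only [Complex.norm_ofNat]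
    rw [div_le_iff₀ (by positivity)]; linarith
  have hv' : ‖v‖ ≤ 1 / 2 := by linarith
  -- the exponent `J` of `g_t' = exp J`
  have hbn : ‖(-2 : ℂ) * t / z ^ 2‖ ≤ 2 * α ^ 2 := by
    rw [norm_div, norm_mul, norm_pow, norm_neg, Complex.norm_real, Real.norm_eq_abs,
      abs_of_nonneg t.coe_nonneg]
    simp only [Complex.norm_ofNat]
    rw [div_le_iff₀ (by positivity)]
    linarith
  have hJn : ‖J‖ ≤ 3 * α ^ 2 := by
    calc ‖J‖ = ‖(J - (-2 * t / z ^ 2)) + (-2 * t / z ^ 2)‖ := by rw [sub_add_cancel]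
      _ ≤ ‖J - (-2 * t / z ^ 2)‖ + ‖(-2 : ℂ) * t / z ^ 2‖ := norm_add_le _ _
      _ ≤ 10 * α ^ 3 + 2 * α ^ 2 := add_le_add hJ hbn
      _ ≤ 3 * α ^ 2 := by linarith [sq_nonneg α]
  have hJ1 : ‖J‖ ≤ 1 := by linarith
  -- branch pinning: `g_t - W_t = z (1 + v)`, `Re (1 + v) > 0`, `arg z = π/2`; `g_t' = exp J`
  have hG : map W t z - W t = z * (1 + v) := by rw [hmap, hvdef]; field_simp; ring
  have h1v := re_one_add_pos hv'
  have hlogG : log (map W t z - W t) = log z + log (1 + v) := by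
    rw [hG, hzdef]; exact log_I_mul_mul_of_re_pos hy h1v
  have hlogD : log (deriv (map W t) z) = J := by rw [hder]; exact log_exp_of_norm_le_one hJ1
  have hexp : (5 / 8 : ℂ) * (2 * log z + log (deriv (map W t) z) - 2 * log (map W t z - W t)) =
      (5 / 8 : ℂ) * (J - 2 * log (1 + v)) := by
    rw [hlogD, hlogG]; ring
  rw [hexp]
  -- the logarithm of `1 + v`
  set L := log (1 + v) with hLdef
  have hRL : ‖L - (v - v ^ 2 / 2)‖ ≤ 8 * α ^ 3 := by
    calc ‖L - (v - v ^ 2 / 2)‖ ≤ ‖v‖ ^ 3 := norm_log_one_add_sub_quadratic_le hv'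
      _ ≤ (2 * α) ^ 3 := by gcongr
      _ = 8 * α ^ 3 := by ring
  have hva : ‖v - a‖ ≤ 3 * α ^ 2 := by
    calc ‖v - a‖ = ‖(v - (a + b)) + b‖ := by congr 1; ring
      _ ≤ ‖v - (a + b)‖ + ‖b‖ := norm_add_le _ _
      _ ≤ 3 * α ^ 3 + 2 * α ^ 2 := add_le_add hv1 hb
      _ ≤ 3 * α ^ 2 := by linarith [sq_nonneg α]
  have hva' : ‖v + a‖ ≤ 3 * α := by
    calc ‖v + a‖ ≤ ‖v‖ + ‖a‖ := norm_add_le _ _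
      _ ≤ 2 * α + α := add_le_add hv0 ha
      _ = 3 * α := by ring
  -- the exponent `E`, its second-order part `E₀` and its first-order part `c`
  set E : ℂ := (5 / 8 : ℂ) * (J - 2 * L) with hEdef
  set E₀ : ℂ := (5 / 8 : ℂ) * (-2 * a - 3 * b + a ^ 2) with hE₀def
  set c : ℂ := -(5 / 4 : ℂ) * a with hcdef
  have h58 : ‖(5 / 8 : ℂ)‖ = 5 / 8 := by simp
  have hEE₀ : ‖E - E₀‖ ≤ 26 * α ^ 3 := by
    have hid : E - E₀ = (5 / 8 : ℂ) * ((J - (-2 * t / z ^ 2)) - 2 * (v - (a + b)) +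
        (v - a) * (v + a) - 2 * (L - (v - v ^ 2 / 2))) := by
      rw [hEdef, hE₀def, hbdef]; ring
    rw [hid, norm_mul, h58]
    calc 5 / 8 * ‖(J - (-2 * t / z ^ 2)) - 2 * (v - (a + b)) + (v - a) * (v + a) -
          2 * (L - (v - v ^ 2 / 2))‖
        ≤ 5 / 8 * (‖J - (-2 * t / z ^ 2)‖ + ‖(2 : ℂ) * (v - (a + b))‖ + ‖(v - a) * (v + a)‖ +
            ‖(2 : ℂ) * (L - (v - v ^ 2 / 2))‖) := by
          gcongr
          refine (norm_sub_le _ _).trans ?_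
          gcongr
          refine (norm_add_le _ _).trans ?_
          gcongr
          exact norm_sub_le _ _
      _ = 5 / 8 * (‖J - (-2 * t / z ^ 2)‖ + 2 * ‖v - (a + b)‖ + ‖v - a‖ * ‖v + a‖ +
            2 * ‖L - (v - v ^ 2 / 2)‖) := by
          simp only [norm_mul, Complex.norm_ofNat]
      _ ≤ 5 / 8 * (10 * α ^ 3 + 2 * (3 * α ^ 3) + 3 * α ^ 2 * (3 * α) + 2 * (8 * α ^ 3)) := by
          gcongr
      _ ≤ 26 * α ^ 3 := by linarith [pow_nonneg hα0 3]
  have hc : ‖c‖ ≤ 5 / 4 * α := by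
    have h54 : ‖(5 / 4 : ℂ)‖ = 5 / 4 := by simp
    rw [hcdef, norm_mul, norm_neg, h54]
    gcongr
  have hE₀c : ‖E₀ - c‖ ≤ 9 / 2 * α ^ 2 := by
    have hid : E₀ - c = (5 / 8 : ℂ) * (-3 * b + a ^ 2) := by rw [hE₀def, hcdef]; ring
    rw [hid, norm_mul, h58]
    calc 5 / 8 * ‖-3 * b + a ^ 2‖ ≤ 5 / 8 * (‖(-3 : ℂ) * b‖ + ‖a ^ 2‖) := by
          gcongr; exact norm_add_le _ _
      _ = 5 / 8 * (3 * ‖b‖ + ‖a‖ ^ 2) := by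
          simp only [norm_mul, norm_neg, norm_pow, Complex.norm_ofNat]
      _ ≤ 5 / 8 * (3 * (2 * α ^ 2) + α ^ 2) := by gcongr
      _ ≤ 9 / 2 * α ^ 2 := by linarith [sq_nonneg α]
  have hEc : ‖E - c‖ ≤ 5 * α ^ 2 := by
    calc ‖E - c‖ = ‖(E - E₀) + (E₀ - c)‖ := by rw [sub_add_sub_cancel]
      _ ≤ ‖E - E₀‖ + ‖E₀ - c‖ := norm_add_le _ _
      _ ≤ 26 * α ^ 3 + 9 / 2 * α ^ 2 := add_le_add hEE₀ hE₀c
      _ ≤ 5 * α ^ 2 := by linarith [sq_nonneg α]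
  have hEn : ‖E‖ ≤ 2 * α := by
    calc ‖E‖ = ‖(E - c) + c‖ := by rw [sub_add_cancel]
      _ ≤ ‖E - c‖ + ‖c‖ := norm_add_le _ _
      _ ≤ 5 * α ^ 2 + 5 / 4 * α := add_le_add hEc hc
      _ ≤ 2 * α := by linarith
  have hEc' : ‖E + c‖ ≤ 4 * α := by
    calc ‖E + c‖ ≤ ‖E‖ + ‖c‖ := norm_add_le _ _
      _ ≤ 2 * α + 5 / 4 * α := add_le_add hEn hc
      _ ≤ 4 * α := by linarith
  have hE1 : ‖E‖ ≤ 1 := by linarith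
  have hRE : ‖cexp E - (1 + E + E ^ 2 / 2)‖ ≤ 8 * α ^ 3 := by
    calc ‖cexp E - (1 + E + E ^ 2 / 2)‖ ≤ ‖E‖ ^ 3 := norm_exp_sub_quadratic_le hE1
      _ ≤ (2 * α) ^ 3 := by gcongr
      _ = 8 * α ^ 3 := by ring
  -- the target in terms of `E₀`, `c`
  have hT : (1 : ℂ) + (5 / 4 : ℂ) * (W t : ℂ) / z +
      (45 / 32 : ℂ) * ((W t : ℂ) ^ 2 - (8 / 3 : ℂ) * t) / z ^ 2 = 1 + E₀ + c ^ 2 / 2 := by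
    rw [hE₀def, hcdef, hadef, hbdef]; field_simp; ring
  rw [hT]
  have hid : cexp E - (1 + E₀ + c ^ 2 / 2) =
      (cexp E - (1 + E + E ^ 2 / 2)) + (E - E₀) + (E - c) * (E + c) / 2 := by ring
  rw [hid]
  calc ‖(cexp E - (1 + E + E ^ 2 / 2)) + (E - E₀) + (E - c) * (E + c) / 2‖
      ≤ ‖cexp E - (1 + E + E ^ 2 / 2)‖ + ‖E - E₀‖ + ‖(E - c) * (E + c) / 2‖ := norm_add₃_le
    _ = ‖cexp E - (1 + E + E ^ 2 / 2)‖ + ‖E - E₀‖ + ‖E - c‖ * ‖E + c‖ / 2 := by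
        simp only [norm_div, norm_mul, Complex.norm_ofNat]
    _ ≤ 8 * α ^ 3 + 26 * α ^ 3 + 5 * α ^ 2 * (4 * α) / 2 := by gcongr
    _ = 44 * α ^ 3 := by ring
    _ ≤ 100 * α ^ 3 := by linarith [pow_nonneg hα0 3]

/-- Real and imaginary parts of the main term at `z = iy` (`w`, `s` real, `y ≠ 0`):
`1 + (5/4) w/(iy) + (45/32)(w² - (8/3)s)/(iy)² = (1 - (45/32)(w² - (8/3)s)/y²) - (5w/(4y)) i`
(`1/(iy) = -i/y`, `1/(iy)² = -1/y²`). [folklore] -/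
theorem saw_main_term_eq {y : ℝ} (hy : y ≠ 0) (w s : ℝ) :
    (1 : ℂ) + (5 / 4 : ℂ) * (w : ℂ) / (I * y) +
        (45 / 32 : ℂ) * ((w : ℂ) ^ 2 - (8 / 3 : ℂ) * s) / (I * y) ^ 2 =
      ((1 - 45 / (32 * y ^ 2) * (w ^ 2 - 8 / 3 * s) : ℝ) : ℂ) +
        ((-(5 / (4 * y) * w) : ℝ) : ℂ) * I := by
  have hy' : (y : ℂ) ≠ 0 := by exact_mod_cast hy
  push_cast
  field_simp
  ring_nf
  simp only [I_sq, I_pow_three]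
  ring

/-- **Imaginary part of the spin-5/8 observable at `iy` in the far field**:
`|Im N_t(iy) + (5/4) W_t/y| ≤ 100 ((K + √t)/y)³` — to this order `Im N_t(iy)` is the multiple
`-(5/(4y)) W_t` of the driving function. [cite: DuminilCopinSmirnov2012, §4 Conjecture 2] -/
theorem abs_im_sawParaObservable_add_le (h : FarRegime W (I * y) t K) (hy : 0 < y) :
    |(cexp ((5 / 8 : ℂ) * (2 * log (I * y) + log (deriv (map W t) (I * y)) -
          2 * log (map W t (I * y) - W t)))).im + 5 / (4 * y) * W t| ≤
      100 * ((K + Real.sqrt t) / y) ^ 3 := by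
  have hmain := h.norm_sawParaObservable_sub_le hy
  have hnorm : ‖I * (y : ℂ)‖ = y := by simp [abs_of_pos hy]
  rw [hnorm, saw_main_term_eq hy.ne'] at hmain
  set a : ℝ := 1 - 45 / (32 * y ^ 2) * (W t ^ 2 - 8 / 3 * t) with ha
  set b : ℝ := -(5 / (4 * y) * W t) with hb
  set O := cexp ((5 / 8 : ℂ) * (2 * log (I * y) + log (deriv (map W t) (I * y)) -
    2 * log (map W t (I * y) - W t))) with hO
  have him : (O - ((a : ℂ) + (b : ℂ) * I)).im = O.im + 5 / (4 * y) * W t := by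
    simp only [sub_im, add_im, ofReal_im, mul_im, ofReal_re, I_re, I_im, mul_zero, mul_one,
      zero_add, add_zero, hb]
    ring
  rw [← him]
  exact (abs_im_le_norm _).trans hmain

/-- **Real part of the spin-5/8 observable at `iy` in the far field**:
`|Re N_t(iy) - (1 - (45/32)(W_t² - (8/3)t)/y²)| ≤ 100 ((K + √t)/y)³` — to this order
`Re N_t(iy)` is an affine function of `W_t² - (8/3) t`. [cite: DuminilCopinSmirnov2012, §4 Conjecture 2] -/
theorem abs_re_sawParaObservable_sub_le (h : FarRegime W (I * y) t K) (hy : 0 < y) :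
    |(cexp ((5 / 8 : ℂ) * (2 * log (I * y) + log (deriv (map W t) (I * y)) -
          2 * log (map W t (I * y) - W t)))).re - (1 - 45 / (32 * y ^ 2) * (W t ^ 2 - 8 / 3 * t))| ≤
      100 * ((K + Real.sqrt t) / y) ^ 3 := by
  have hmain := h.norm_sawParaObservable_sub_le hy
  have hnorm : ‖I * (y : ℂ)‖ = y := by simp [abs_of_pos hy]
  rw [hnorm, saw_main_term_eq hy.ne'] at hmain
  set a : ℝ := 1 - 45 / (32 * y ^ 2) * (W t ^ 2 - 8 / 3 * t) with ha
  set b : ℝ := -(5 / (4 * y) * W t) with hb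
  set O := cexp ((5 / 8 : ℂ) * (2 * log (I * y) + log (deriv (map W t) (I * y)) -
    2 * log (map W t (I * y) - W t))) with hO
  have hre : (O - ((a : ℂ) + (b : ℂ) * I)).re = O.re - a := by
    simp only [sub_re, add_re, ofReal_re, mul_re, ofReal_im, I_re, I_im, mul_zero, mul_one,
      sub_zero, add_zero]
  rw [← hre]
  exact (abs_re_le_norm _).trans hmain

end FarRegime

end Loewner

end Literature.Probability.RandomPlanarGeometry
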